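import Summits.MatrixMultiplication.MatrixMultiplication.Theorems.ObstructionDescentUniversalOccurrenceTwoRectangleOddFiveTableaux
import Summits.MatrixMultiplication.MatrixMultiplication.Theorems.ObstructionDescentUniversalOccurrenceTwoRectangleOddFiveArith

set_option linter.dupNamespace false
set_option autoImplicit false

/-!
# Universal occurrence — two rectangles and the type `(2N-7,5,1,1)`, part C: domino bookkeeping (decomp-mm · lens 3 · gen 44)

Route `route-MatrixMultiplication-ObstructionDescent` (sub-problem `MatrixMultiplication`, `ω(ℂ) = 2`); SUPPORT for the crux
`NoOccurrenceObstruction` (`P_O`, item `stmt-MatrixMultiplication-29040`); an input of the third four-odd family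
`((2^N),(2^N),(2N-7,5,1,1)) ∈ S(⟨m⟩)`, `m ≥ N + 2`, `N ≥ 6` (part E, `…TwoRectangleOddFive`).  No `def`, no `sorry`.

In the lifted design `D'₂(N)` (first leg `φ = (0,…,N-1 | 0,1)`, row letter `γ(1) = γ(2) = γ(3) = 1, γ(N) = 2, γ(N+1) = 3`,
`γ = 0` otherwise, blocks `e = (q mod 2, q div 2)`), a non-zero term has a block-bijective first-leg word `x = φ ∘ ι` and a
third-leg word `w = γ ∘ ι` supported on the tableau (zero on the arm `q ≥ 12`, `< 2` on the dominoes `4..11`).  Block `0`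
consists of the cells `0, 2` (column), `4, 6, 8, 10` (domino tops) and even arm cells; it carries the `x`-letters `1, 2, 3` exactly
once each, never on the arm, and on a domino only as `ι = 1, 2, 3` (row letter `1`).  Hence the DOMINO SUM `d = w(4)+w(6)+w(8)+w(10)`
is determined by the two column letters `n₀ = ι(0), n₂ = ι(2)` of block `0`:
`d + [n₀ ∈ {2,3}] + [n₂ ∈ {2,3}] + [{n₀,n₂} ∩ {1,N+1} ≠ ∅] = 3` (`oddFive_domino_sum`; slot count of part B).

[cite: BurgisserIkenmeyer2011, Thm. 4.4] [cite: BurgisserIkenmeyer2017, §5, Thm. 5.9 (proof of (2)), eq. (3.4)]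
-/

noncomputable section

namespace Summit.MatrixMultiplication.MatrixMultiplication.Theorems.ObstructionCalculus

open Literature.Computability.AlgebraicComplexity
open Literature.NumberTheory.DiophantineGeometry

set_option maxHeartbeats 800000 in
/-- **Domino sum of block `0`.**  For a block-bijective first-leg word `x = φ ∘ ι` and a third-leg word `w = γ ∘ ι` that
vanishes on the arm and is `< 2` on the dominoes,
`w(4) + w(6) + w(8) + w(10) + [ι 0 ∈ {2,3}] + [ι 2 ∈ {2,3}] + [{ι 0, ι 2} ∩ {1, N+1} ≠ ∅] = 3`. [this node] -/
theorem oddFive_domino_sum {N : ℕ} (hN : 6 ≤ N) (e : Fin (N * 2) ≃ Fin 2 × Fin N)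
    (hesymm : ∀ (a : Fin 2) (j : Fin N), ((e.symm (a, j) : Fin (N * 2)) : ℕ) = (a : ℕ) + 2 * (j : ℕ))
    (ι : Fin (N * 2) → Fin (N + 2)) (x w : Word N (N * 2))
    (hxv : ∀ q, ((x q : Fin N) : ℕ) =
      if ((ι q : Fin (N + 2)) : ℕ) < N then ((ι q : Fin (N + 2)) : ℕ) else ((ι q : Fin (N + 2)) : ℕ) - N)
    (hwv : ∀ q, ((w q : Fin N) : ℕ) =
      if ((ι q : Fin (N + 2)) : ℕ) = 1 then 1 else if ((ι q : Fin (N + 2)) : ℕ) = 2 then 1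
        else if ((ι q : Fin (N + 2)) : ℕ) = 3 then 1 else if ((ι q : Fin (N + 2)) : ℕ) = N then 2
        else if ((ι q : Fin (N + 2)) : ℕ) = N + 1 then 3 else 0)
    (hbx0 : Function.Bijective (fun j => x (e.symm (0, j))))
    (harm : ∀ q : Fin (N * 2), 12 ≤ (q : ℕ) → ((w q : Fin N) : ℕ) = 0)
    (hdom : ∀ q : Fin (N * 2), 4 ≤ (q : ℕ) → (q : ℕ) < 12 → ((w q : Fin N) : ℕ) < 2)
    {p0 p2 p4 p6 p8 p10 : Fin (N * 2)} (hp0 : (p0 : ℕ) = 0) (hp2 : (p2 : ℕ) = 2) (hp4 : (p4 : ℕ) = 4) (hp6 : (p6 : ℕ) = 6)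
    (hp8 : (p8 : ℕ) = 8) (hp10 : (p10 : ℕ) = 10) :
    ((w p4 : Fin N) : ℕ) + ((w p6 : Fin N) : ℕ) + ((w p8 : Fin N) : ℕ) + ((w p10 : Fin N) : ℕ) +
      ((if ((ι p0 : Fin (N + 2)) : ℕ) = 2 ∨ ((ι p0 : Fin (N + 2)) : ℕ) = 3 then 1 else 0) +
        (if ((ι p2 : Fin (N + 2)) : ℕ) = 2 ∨ ((ι p2 : Fin (N + 2)) : ℕ) = 3 then 1 else 0) +
        (if ((ι p0 : Fin (N + 2)) : ℕ) = 1 ∨ ((ι p2 : Fin (N + 2)) : ℕ) = 1 ∨ ((ι p0 : Fin (N + 2)) : ℕ) = N + 1 ∨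
            ((ι p2 : Fin (N + 2)) : ℕ) = N + 1 then 1 else 0)) = 3 := by
  classical
  -- the six slots of block `0` below the arm, and the cells they index
  obtain ⟨t0, ht0⟩ : ∃ s : Fin N, (s : ℕ) = 0 := ⟨⟨0, by omega⟩, rfl⟩
  obtain ⟨t1, ht1⟩ : ∃ s : Fin N, (s : ℕ) = 1 := ⟨⟨1, by omega⟩, rfl⟩
  obtain ⟨t2, ht2⟩ : ∃ s : Fin N, (s : ℕ) = 2 := ⟨⟨2, by omega⟩, rfl⟩
  obtain ⟨t3, ht3⟩ : ∃ s : Fin N, (s : ℕ) = 3 := ⟨⟨3, by omega⟩, rfl⟩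
  obtain ⟨t4, ht4⟩ : ∃ s : Fin N, (s : ℕ) = 4 := ⟨⟨4, by omega⟩, rfl⟩
  obtain ⟨t5, ht5⟩ : ∃ s : Fin N, (s : ℕ) = 5 := ⟨⟨5, by omega⟩, rfl⟩
  have hc0 : e.symm (0, t0) = p0 := Fin.ext (by rw [hesymm, hp0, ht0]; simp)
  have hc2 : e.symm (0, t1) = p2 := Fin.ext (by rw [hesymm, hp2, ht1]; simp)
  have hc4 : e.symm (0, t2) = p4 := Fin.ext (by rw [hesymm, hp4, ht2]; simp)
  have hc6 : e.symm (0, t3) = p6 := Fin.ext (by rw [hesymm, hp6, ht3]; simp)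
  have hc8 : e.symm (0, t4) = p8 := Fin.ext (by rw [hesymm, hp8, ht4]; simp)
  have hc10 : e.symm (0, t5) = p10 := Fin.ext (by rw [hesymm, hp10, ht5]; simp)
  -- letters versus `x`-letters and row letters
  have hι2 : ∀ q, ((ι q : Fin (N + 2)) : ℕ) = 2 ↔ ((x q : Fin N) : ℕ) = 2 := fun q => by
    rw [hxv]; have := (ι q).2; constructor <;> intro h <;> split_ifs at * <;> omega
  have hι3 : ∀ q, ((ι q : Fin (N + 2)) : ℕ) = 3 ↔ ((x q : Fin N) : ℕ) = 3 := fun q => by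
    rw [hxv]; have := (ι q).2; constructor <;> intro h <;> split_ifs at * <;> omega
  have hι1 : ∀ q, (((ι q : Fin (N + 2)) : ℕ) = 1 ∨ ((ι q : Fin (N + 2)) : ℕ) = N + 1) ↔ ((x q : Fin N) : ℕ) = 1 :=
    fun q => by rw [hxv]; have := (ι q).2; constructor <;> intro h <;> split_ifs at * <;> omega
  have hw1 : ∀ q, ((w q : Fin N) : ℕ) = 1 ↔
      (((ι q : Fin (N + 2)) : ℕ) = 1 ∨ ((ι q : Fin (N + 2)) : ℕ) = 2 ∨ ((ι q : Fin (N + 2)) : ℕ) = 3) :=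
    fun q => by rw [hwv]; constructor <;> intro h <;> split_ifs at * <;> omega
  have hw3 : ∀ q, ((ι q : Fin (N + 2)) : ℕ) = N + 1 → ((w q : Fin N) : ℕ) = 3 := fun q hq => by
    rw [hwv]; split_ifs <;> omega
  -- the cells of block `0` carrying the `x`-letters `1`, `2`, `3`
  obtain ⟨j1, hj1⟩ := hbx0.2 t1
  obtain ⟨j2, hj2⟩ := hbx0.2 t2
  obtain ⟨j3, hj3⟩ := hbx0.2 t3
  have hj1v : ((x (e.symm (0, j1)) : Fin N) : ℕ) = 1 := by
    have h := congrArg Fin.val hj1; dsimp only at h; rw [ht1] at h; exact h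
  have hj2v : ((x (e.symm (0, j2)) : Fin N) : ℕ) = 2 := by
    have h := congrArg Fin.val hj2; dsimp only at h; rw [ht2] at h; exact h
  have hj3v : ((x (e.symm (0, j3)) : Fin N) : ℕ) = 3 := by
    have h := congrArg Fin.val hj3; dsimp only at h; rw [ht3] at h; exact h
  have hj12 : (j1 : ℕ) ≠ (j2 : ℕ) := fun h => by
    have h' : j1 = j2 := Fin.ext h
    rw [h'] at hj1v; omega
  have hj13 : (j1 : ℕ) ≠ (j3 : ℕ) := fun h => by
    have h' : j1 = j3 := Fin.ext h
    rw [h'] at hj1v; omega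
  have hj23 : (j2 : ℕ) ≠ (j3 : ℕ) := fun h => by
    have h' : j2 = j3 := Fin.ext h
    rw [h'] at hj2v; omega
  have hj2lt : (j2 : ℕ) < 6 := by
    have hι := (hι2 _).2 hj2v
    have hw : ((w (e.symm (0, j2)) : Fin N) : ℕ) = 1 := (hw1 _).2 (Or.inr (Or.inl hι))
    by_contra hcon
    have h0 := harm (e.symm (0, j2)) (by rw [hesymm]; simp; omega)
    omega
  have hj3lt : (j3 : ℕ) < 6 := by
    have hι := (hι3 _).2 hj3v
    have hw : ((w (e.symm (0, j3)) : Fin N) : ℕ) = 1 := (hw1 _).2 (Or.inr (Or.inr hι))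
    by_contra hcon
    have h0 := harm (e.symm (0, j3)) (by rw [hesymm]; simp; omega)
    omega
  have hj1lt : (j1 : ℕ) < 6 := by
    have hι := (hι1 _).2 hj1v
    have hw : ((w (e.symm (0, j1)) : Fin N) : ℕ) ≠ 0 := by
      rcases hι with h | h
      · have := (hw1 _).2 (Or.inl h); omega
      · have := hw3 _ h; omega
    by_contra hcon
    exact hw (harm (e.symm (0, j1)) (by rw [hesymm]; simp; omega))
  -- slot dichotomy from block-injectivity
  have slot : ∀ (s jv : Fin N) (v : ℕ), ((x (e.symm (0, jv)) : Fin N) : ℕ) = v →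
      (((x (e.symm (0, s)) : Fin N) : ℕ) = v ∧ (jv : ℕ) = (s : ℕ)) ∨
        (((x (e.symm (0, s)) : Fin N) : ℕ) ≠ v ∧ (jv : ℕ) ≠ (s : ℕ)) := by
    intro s jv v hv
    by_cases h : jv = s
    · left; rw [← h]; exact ⟨hv, rfl⟩
    · right
      exact ⟨fun h' => h (hbx0.1 (Fin.ext (hv.trans h'.symm))), fun h' => h (Fin.ext h')⟩
  -- a domino cell of block `0` reads `[j₁ = s] + [j₂ = s] + [j₃ = s]` (`s` its slot)
  have cellv : ∀ (s : Fin N) (c : Fin (N * 2)), e.symm (0, s) = c → 4 ≤ (c : ℕ) → (c : ℕ) < 12 →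
      ((w c : Fin N) : ℕ) =
        (if (j1 : ℕ) = (s : ℕ) then 1 else 0) + (if (j2 : ℕ) = (s : ℕ) then 1 else 0) +
          (if (j3 : ℕ) = (s : ℕ) then 1 else 0) := by
    intro s c hsc hc4 hc12
    have A := slot s j2 2 hj2v; have B := slot s j1 1 hj1v; have C := slot s j3 3 hj3v
    rw [hsc] at A B C
    have hd := hdom c hc4 hc12
    have e2 := hι2 c; have e3 := hι3 c; have e1 := hι1 c; have f1 := hw1 c; have f3 := hw3 c
    split_ifs <;> omega
  have hw4 := cellv t2 p4 hc4 (by omega) (by omega)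
  have hw6 := cellv t3 p6 hc6 (by omega) (by omega)
  have hw8 := cellv t4 p8 hc8 (by omega) (by omega)
  have hw10 := cellv t5 p10 hc10 (by omega) (by omega)
  rw [ht2] at hw4
  rw [ht3] at hw6
  rw [ht4] at hw8
  rw [ht5] at hw10
  -- a column cell of block `0` carries a one-generic letter iff it is the slot of `j₂` or `j₃`
  have colv : ∀ (s : Fin N) (c : Fin (N * 2)), e.symm (0, s) = c →
      (if ((ι c : Fin (N + 2)) : ℕ) = 2 ∨ ((ι c : Fin (N + 2)) : ℕ) = 3 then 1 else 0) =
        (if (j2 : ℕ) = (s : ℕ) ∨ (j3 : ℕ) = (s : ℕ) then 1 else 0 : ℕ) := by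
    intro s c hsc
    have A := slot s j2 2 hj2v; have C := slot s j3 3 hj3v
    rw [hsc] at A C
    have e2 := hι2 c; have e3 := hι3 c
    split_ifs <;> omega
  have hcolA := colv t0 p0 hc0
  have hcolB := colv t1 p2 hc2
  rw [ht0] at hcolA
  rw [ht1] at hcolB
  have hcol1 : (if ((ι p0 : Fin (N + 2)) : ℕ) = 1 ∨ ((ι p2 : Fin (N + 2)) : ℕ) = 1 ∨ ((ι p0 : Fin (N + 2)) : ℕ) = N + 1 ∨
        ((ι p2 : Fin (N + 2)) : ℕ) = N + 1 then 1 else 0) = (if (j1 : ℕ) = 0 ∨ (j1 : ℕ) = 1 then 1 else 0 : ℕ) := by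
    have B := slot t0 j1 1 hj1v; have B' := slot t1 j1 1 hj1v
    rw [hc0, ht0] at B
    rw [hc2, ht1] at B'
    have e0 := hι1 p0; have e2 := hι1 p2
    split_ifs <;> omega
  rw [hw4, hw6, hw8, hw10, hcolA, hcolB, hcol1]
  have h := oddFive_slot_count j1 j2 j3 hj1lt hj2lt hj3lt hj12 hj13 hj23
  omega

end Summit.MatrixMultiplication.MatrixMultiplication.Theorems.ObstructionCalculus

end
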